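/-
Copyright: pub-hodgecm formalisation cell (harness21, 2026). New file (not vendored).
Origin: HOME/pub-hodgecm-landherr/LandherrNecessity.lean (unit pub-hodgecm-landherr,
session planner-pub-hodgecm-landherr-0), expansion part (c), companion to `LandherrClassification.lean`; handover 2026-08-18T03:10:19Z
(md5 3b5ad97e), landed VERBATIM by the gen-5 packager as `HodgeCM/Proofs/LandherrNecessity.lean` (run 15).
-/
import Summits.HodgeConjecture.HodgeCM.StubTree.Inputs
import Summits.HodgeConjecture.HodgeCM.Proofs.Landherr

/-!
# Lemma 3.3(b), Landherr half — necessity of the invariants (the easy direction, fully proved)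

`HodgeCM.Lemma33bLandherr` (Inputs.lean) asserts that equal SIGNS at every complex embedding and equal
DISCRIMINANT CLASS in `L₀^× / N(L^×)` suffice for two non-degenerate diagonal hermitian planes
`⟨a₀, a₁⟩`, `⟨a₂, a₃⟩` over the CM field `L` to be isometric.  This file proves the converse —
`HodgeCM.lemma33bLandherr_converse`: an isometry `ᵗ(σg) · diag(a₀,a₁) · g = diag(a₂,a₃)`, `g ∈ GL₂(L)`,
forces both invariants — so that the typed target is exactly Landherr's CLASSIFICATION in rank 2
(Landherr, Abh. Math. Sem. Hamburg 11 (1936); Deligne, LNM 900, Prop. 4.1 p. 44: hermitian forms over a CM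
field relative to `E/F` are classified by the signatures `(a_τ, b_τ)` and the discriminant in
`F^×/N E^×`), as PerL v5 (tex l. 299) quotes it.  No unproved input is used here.

Proof: determinant of the isometry identity gives `σ(det g) · a₀a₁ · det g = a₂a₃`, whence
`a₀a₁ = a₂a₃ N((det g)⁻¹)`; the diagonal entries give `a₀ N(g₀₀) + a₁ N(g₁₀) = a₂`,
`a₀ N(g₀₁) + a₁ N(g₁₁) = a₃`; at an embedding `τ` these become real identities
`r₀‖·‖² + r₁‖·‖² = r₂`, `… = r₃`, `r₀r₁‖τ det g‖² = r₂r₃` (`rᵢ = Re τ(aᵢ) = τ(aᵢ)`), from which the two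
sign multisets agree by a four-way sign case analysis (Sylvester's law of inertia for binary forms).
-/

noncomputable section

open NumberField
open scoped Matrix

namespace HodgeCM

open Literature.AlgebraicGeometry.ShimuraVarieties (conjRingHomK embedding_conjRingHomK)

namespace Lemma33bLandherrProof

variable (L : CMField)

/-- A `σ`-fixed element is real at every complex embedding. -/
theorem embedding_eq_re {x : L} (hx : conjRingHomK L x = x) (τ : L →+* ℂ) :
    τ x = ((τ x).re : ℂ) := by
  have h := embedding_conjRingHomK L τ x
  rw [hx] at h
  exact (Complex.conj_eq_iff_re.mp h.symm).symm

/-- `τ (a · x · σx) ` is the real number `Re τ(a) · ‖τ x‖²` for `σ`-fixed `a`. -/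
theorem embedding_mul_norm {a x : L} (ha : conjRingHomK L a = a) (τ : L →+* ℂ) :
    τ (a * (x * conjRingHomK L x)) = (((τ a).re * ‖τ x‖ ^ 2 : ℝ) : ℂ) := by
  rw [map_mul, embedding_mul_conjRingHomK, embedding_eq_re L ha τ]
  push_cast
  simp

/-- **Necessity of Landherr's invariants (rank 2).**  If `g ∈ GL₂(L)` is an isometry
`ᵗ(σg) · diag(a₀, a₁) · g = diag(a₂, a₃)` between non-degenerate diagonal hermitian planes with
`σ`-fixed entries, then the planes have the same signs at every complex embedding and the same
discriminant class: `a₀a₁ = a₂a₃ · N(z)` with `z = (det g)⁻¹`. -/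
theorem invariants_of_isometry (a : Fin 4 → L) (ha : ∀ i, conjRingHomK L (a i) = a i)
    (ha0 : ∀ i, a i ≠ 0) (g : GL (Fin 2) L)
    (hg : ((g : Matrix (Fin 2) (Fin 2) L).transpose.map (conjRingHomK L)) * Matrix.diagonal ![a 0, a 1] *
        (g : Matrix (Fin 2) (Fin 2) L) = Matrix.diagonal ![a 2, a 3]) :
    (∀ τ : L →+* ℂ,
      ({decide (0 < (τ (a 0)).re), decide (0 < (τ (a 1)).re)} : Multiset Bool) =
        {decide (0 < (τ (a 2)).re), decide (0 < (τ (a 3)).re)}) ∧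
    ∃ z : L, z ≠ 0 ∧ a 0 * a 1 = a 2 * a 3 * (z * conjRingHomK L z) := by
  set G : Matrix (Fin 2) (Fin 2) L := (g : Matrix (Fin 2) (Fin 2) L) with hG
  have hD : G.det ≠ 0 := (Matrix.isUnits_det_units g).ne_zero
  -- the two diagonal entries of the isometry identity
  have e00 : a 0 * (G 0 0 * conjRingHomK L (G 0 0)) + a 1 * (G 1 0 * conjRingHomK L (G 1 0)) = a 2 := by
    have h := congrArg (fun M => M 0 0) hg
    simp only [Matrix.mul_apply, Fin.sum_univ_two, Matrix.diagonal, Matrix.map_apply,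
      Matrix.transpose_apply, Matrix.of_apply] at h
    simp at h
    linear_combination h
  have e11 : a 0 * (G 0 1 * conjRingHomK L (G 0 1)) + a 1 * (G 1 1 * conjRingHomK L (G 1 1)) = a 3 := by
    have h := congrArg (fun M => M 1 1) hg
    simp only [Matrix.mul_apply, Fin.sum_univ_two, Matrix.diagonal, Matrix.map_apply,
      Matrix.transpose_apply, Matrix.of_apply] at h
    simp at h
    linear_combination h
  -- the determinant of the isometry identity
  have edet : (a 0 * a 1) * (G.det * conjRingHomK L G.det) = a 2 * a 3 := by
    have h := congrArg Matrix.det hg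
    rw [Matrix.det_mul, Matrix.det_mul] at h
    have h1 : (G.transpose.map (conjRingHomK L)).det = conjRingHomK L G.det := by
      rw [← RingHom.mapMatrix_apply, ← RingHom.map_det, Matrix.det_transpose]
    rw [h1, Matrix.det_diagonal, Matrix.det_diagonal, Fin.prod_univ_two, Fin.prod_univ_two] at h
    simp at h
    linear_combination h
  refine ⟨fun τ => ?_, ⟨G.det⁻¹, inv_ne_zero hD, ?_⟩⟩
  · -- signs at `τ`
    have hr : ∀ i, τ (a i) = (((τ (a i)).re : ℝ) : ℂ) := fun i => embedding_eq_re L (ha i) τ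
    have hr0 : ∀ i, (τ (a i)).re ≠ 0 := by
      intro i h0
      exact ha0 i ((map_eq_zero τ).mp (by rw [hr i, h0]; simp))
    have f00 : (τ (a 0)).re * ‖τ (G 0 0)‖ ^ 2 + (τ (a 1)).re * ‖τ (G 1 0)‖ ^ 2 = (τ (a 2)).re := by
      have h := congrArg τ e00
      rw [map_add, embedding_mul_norm L (ha 0), embedding_mul_norm L (ha 1), hr 2] at h
      exact_mod_cast h
    have f11 : (τ (a 0)).re * ‖τ (G 0 1)‖ ^ 2 + (τ (a 1)).re * ‖τ (G 1 1)‖ ^ 2 = (τ (a 3)).re := by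
      have h := congrArg τ e11
      rw [map_add, embedding_mul_norm L (ha 0), embedding_mul_norm L (ha 1), hr 3] at h
      exact_mod_cast h
    have fdet : (τ (a 0)).re * (τ (a 1)).re * ‖τ G.det‖ ^ 2 = (τ (a 2)).re * (τ (a 3)).re := by
      have h := congrArg τ edet
      rw [map_mul τ (a 0 * a 1), map_mul τ (a 0) (a 1), map_mul τ (a 2) (a 3),
        embedding_mul_conjRingHomK, hr 0, hr 1, hr 2, hr 3] at h
      exact_mod_cast h
    have hdd : 0 < ‖τ G.det‖ ^ 2 := by
      have : τ G.det ≠ 0 := (map_ne_zero τ).mpr hD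
      positivity
    have n00 : 0 ≤ ‖τ (G 0 0)‖ ^ 2 := by positivity
    have n10 : 0 ≤ ‖τ (G 1 0)‖ ^ 2 := by positivity
    have n01 : 0 ≤ ‖τ (G 0 1)‖ ^ 2 := by positivity
    have n11 : 0 ≤ ‖τ (G 1 1)‖ ^ 2 := by positivity
    -- four-way sign analysis
    rcases lt_or_gt_of_ne (hr0 0) with h0 | h0 <;> rcases lt_or_gt_of_ne (hr0 1) with h1 | h1
    · -- both negative
      have h2 : (τ (a 2)).re < 0 := lt_of_le_of_ne (by nlinarith) (hr0 2)
      have h3 : (τ (a 3)).re < 0 := lt_of_le_of_ne (by nlinarith) (hr0 3)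
      simp [lt_asymm h0, lt_asymm h1, lt_asymm h2, lt_asymm h3]
    · -- `a₀ < 0 < a₁`
      have h23 : (τ (a 2)).re * (τ (a 3)).re < 0 := by
        rw [← fdet]; exact mul_neg_of_neg_of_pos (mul_neg_of_neg_of_pos h0 h1) hdd
      rcases lt_or_gt_of_ne (hr0 2) with h2 | h2
      · have h3 : 0 < (τ (a 3)).re := by
          by_contra h3; exact absurd h23 (not_lt.mpr (mul_nonneg_of_nonpos_of_nonpos h2.le (not_lt.mp h3)))
        simp [lt_asymm h0, h1, lt_asymm h2, h3]
      · have h3 : (τ (a 3)).re < 0 := by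
          by_contra h3; exact absurd h23 (not_lt.mpr (mul_nonneg h2.le (not_lt.mp h3)))
        simp [lt_asymm h0, h1, h2, lt_asymm h3]
        exact Multiset.pair_comm _ _
    · -- `a₁ < 0 < a₀`
      have h23 : (τ (a 2)).re * (τ (a 3)).re < 0 := by
        rw [← fdet]; exact mul_neg_of_neg_of_pos (mul_neg_of_pos_of_neg h0 h1) hdd
      rcases lt_or_gt_of_ne (hr0 2) with h2 | h2
      · have h3 : 0 < (τ (a 3)).re := by
          by_contra h3; exact absurd h23 (not_lt.mpr (mul_nonneg_of_nonpos_of_nonpos h2.le (not_lt.mp h3)))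
        simp [h0, lt_asymm h1, lt_asymm h2, h3]
        exact Multiset.pair_comm _ _
      · have h3 : (τ (a 3)).re < 0 := by
          by_contra h3; exact absurd h23 (not_lt.mpr (mul_nonneg h2.le (not_lt.mp h3)))
        simp [h0, lt_asymm h1, h2, lt_asymm h3]
    · -- both positive
      have h2 : 0 < (τ (a 2)).re := lt_of_le_of_ne (by nlinarith) (hr0 2).symm
      have h3 : 0 < (τ (a 3)).re := lt_of_le_of_ne (by nlinarith) (hr0 3).symm
      simp [h0, h1, h2, h3]
  · -- discriminant class
    obtain ⟨u, hu⟩ : ∃ u : L, u = G.det⁻¹ := ⟨_, rfl⟩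
    have hu1 : u * G.det = 1 := by rw [hu]; exact inv_mul_cancel₀ hD
    have hu2 : conjRingHomK L u * conjRingHomK L G.det = 1 := by
      have h := congrArg (conjRingHomK L) hu1
      rwa [map_mul, map_one] at h
    rw [← hu]
    linear_combination (u * conjRingHomK L u) * edet
      - (a 0 * a 1 * (conjRingHomK L u * conjRingHomK L G.det)) * hu1 - (a 0 * a 1) * hu2

end Lemma33bLandherrProof

/-- **Converse of `Lemma33bLandherr` (necessity of Landherr's invariants), proved unconditionally.**
If the diagonal hermitian planes `⟨a₀, a₁⟩` and `⟨a₂, a₃⟩` (`aᵢ ∈ L₀^×`) over the CM field `L` are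
isometric (`ᵗ(σg) · diag(a₀,a₁) · g = diag(a₂,a₃)` for some `g ∈ GL₂(L)`), then they have the same signs
at every complex embedding and `a₀a₁ ≡ a₂a₃` in `L₀^×/N(L^×)`.  Together with `HodgeCM.Lemma33bLandherr`
this is Landherr's classification of binary hermitian forms over `L/L₀` (Landherr 1936; Deligne LNM 900
Prop. 4.1), the form quoted in PerL v5, proof of Lemma 3.3(b). -/
theorem lemma33bLandherr_converse (L : CMField) (a : Fin 4 → L)
    (ha : ∀ i, conjRingHomK L (a i) = a i) (ha0 : ∀ i, a i ≠ 0)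
    (hiso : ∃ g : GL (Fin 2) L,
      ((g : Matrix (Fin 2) (Fin 2) L).transpose.map (conjRingHomK L)) * Matrix.diagonal ![a 0, a 1] *
        (g : Matrix (Fin 2) (Fin 2) L) = Matrix.diagonal ![a 2, a 3]) :
    (∀ τ : L →+* ℂ,
      ({decide (0 < (τ (a 0)).re), decide (0 < (τ (a 1)).re)} : Multiset Bool) =
        {decide (0 < (τ (a 2)).re), decide (0 < (τ (a 3)).re)}) ∧
    ∃ z : L, z ≠ 0 ∧ a 0 * a 1 = a 2 * a 3 * (z * conjRingHomK L z) := by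
  obtain ⟨g, hg⟩ := hiso
  exact Lemma33bLandherrProof.invariants_of_isometry L a ha ha0 g hg

end HodgeCM

end
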